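import Summits.KontsevichZagierPeriods.KontsevichZagierPeriods.Theorems.UnfoldedStokesStokesGenerationFibrewiseRungPermutation
import Summits.KontsevichZagierPeriods.KontsevichZagierPeriods.Theorems.UnfoldedStokesStokesGenerationFibrewiseClosureAdd
import Summits.KontsevichZagierPeriods.KontsevichZagierPeriods.Theorems.UnfoldedStokesStokesGenerationFibrewiseClosure
import Summits.KontsevichZagierPeriods.KontsevichZagierPeriods.Theorems.UnfoldedStokesStokesGenerationFibrewiseClosureCongr
import Literature.NumberTheory.Transcendental.SemialgebraicLineDeriv
import Mathlib.Analysis.Calculus.Deriv.Pi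

/-!
# `StokesGeneration` (stmt-KontsevichZagierPeriods-3586) — line `fibrewise_stokes`, stub `stub_landenLeftovers`

Registered rung stub L1d (rung 18, Landen's identity, wave 2) of the line `fibrewise_stokes` of the crux
`StokesGeneration` (route UnfoldedStokes). Rung 18 shows that the cube integrand of LANDEN'S IDENTITY
`Li₂(a) + Li₂(−a/(1−a)) + ½ log²(1−a) = 0` (`a < 1` real algebraic) is fibrewise-Stokes decomposable
(`FibStokesDecomposable`, `Theorems/UnfoldedStokesDefs.lean`) through the homotopy `a ↦ au` on `[0,1]³`
(`x 0 = s`, `x 1 = t`, `x 2 = u`). The three homotopy certificates leave the "leftover"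
`(R₁ + R₂ + R₃)(s,u) + A(s,t,u) + (R₃(t,u) − R₃(s,u))` with `R₁ = a/(1−aus)`, `R₂ = −a/((1−au)(1−au+aus))`,
`R₃(s,u) = (−a/(1−au))·(−au/(1−aus))`, `A = ½(k(s,u)k_u(t,u) − k_u(s,u)k(t,u))`, `k(s,u) = −au/(1−aus)`,
`k_u(s,u) = −a/(1−aus)²`. THIS STUB: the leftover is decomposable by the SOFT relators of rung 12 alone — no
transcendence input, no values:

* `R₁ + R₂ + R₃ = m − m ∘ ρ₀` for `m = (a/(1 − a u))/(1 − a u s)` and the reflection `ρ₀ : s ↦ 1 − s`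
  (`fibStokesDecomposable_sub_comp_reflect`);
* `A = h − h ∘ σ` for `h = ½ k(s,u) k_u(t,u)` and the transposition `σ = (0 1)` (`fibStokesDecomposable_sub_comp_perm`);
* `R₃(t,u) − R₃(s,u) = −(g − g ∘ σ)` for `g = R₃(s,u)` (`fibStokesDecomposable_sub_comp_perm`, `fibStokesDecomposable_neg`).

The regularity hypotheses of rung 12 (semialgebraic continuous partial derivatives in the open fibres) are discharged
once and for all for `ℚ`-semialgebraic functions that are `C¹` on an open neighbourhood of the cube
(`landenLeft_sub_comp_perm_of_contDiffOn`, `landenLeft_sub_comp_reflect_of_contDiffOn`: the partials are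
`x ↦ Dh(x) eᵢ`, semialgebraic by `IsSemialgebraicFunOn.fderiv_apply_single`, Basu–Pollack–Roy Prop. 3.22); here the
neighbourhood is `{0 < 1 − a u s} ∩ {0 < 1 − a u t} ∩ {0 < 1 − a u}`, on which `m`, `h`, `g` are rational functions
with non-vanishing denominators. The three pieces are added (`fibStokesDecomposable_add`) and compared with the
displayed leftover pointwise on the cube (`fibStokesDecomposable_congr_off_null`, empty null set).

References: M. Kontsevich, D. Zagier, *Periods* (2001), §1.2 rules (2), (3); D. Zagier, *The dilogarithm function*
(2007), §I.2; S. Basu, R. Pollack, M.-F. Roy, *Algorithms in Real Algebraic Geometry* (2006), Prop. 3.22.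
-/

noncomputable section

-- `Summit.KontsevichZagierPeriods.KontsevichZagierPeriods.…` is the tree's mandated layout (single-conjunct summit).
set_option linter.dupNamespace false

namespace Summit.KontsevichZagierPeriods.KontsevichZagierPeriods.Cruxes.StokesGeneration.FibrewiseStokes

open MeasureTheory Set
open Literature.NumberTheory.Transcendental
open Literature.NumberTheory.Transcendental.KZ
open Literature.ModelTheory.ExponentialFields (IsSemialgebraic)

/-! ## Rung 12 for `C¹` semialgebraic functions near the cube -/

/-- **Transpositions for `C¹` data.** If `h` is `ℚ`-semialgebraic and `C¹` on an open set `U ⊇ [0,1]^N`, then for every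
permutation `σ` of the coordinates `h − h ∘ σ` is fibrewise-Stokes decomposable: the partial derivatives
`x ↦ Dh(x) eᵢ` are `ℚ`-semialgebraic on `U` (Basu–Pollack–Roy, Prop. 3.22) and continuous, and they are the fibre
derivatives required by `fibStokesDecomposable_sub_comp_perm`. [cite: KontsevichZagier2001, §1.2 rules (2), (3)] -/
theorem landenLeft_sub_comp_perm_of_contDiffOn {N : ℕ} (U : Set (Fin N → ℝ)) (hU : IsOpen U)
    (hCU : Set.pi Set.univ (fun _ : Fin N => Set.Icc (0:ℝ) 1) ⊆ U) (h : (Fin N → ℝ) → ℝ)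
    (hsa : IsSemialgebraicFunOn ℚ U h) (hd : ContDiffOn ℝ 1 h U) (σ : Equiv.Perm (Fin N)) :
    FibStokesDecomposable N (fun x => h x - h (fun l => x (σ l))) := by
  have hC : IsSemialgebraic ℚ (Set.pi Set.univ (fun _ : Fin N => Set.Icc (0:ℝ) 1)) := by
    rw [← cube_eq_pi]; exact isSemialgebraic_cube
  have hdiff : ∀ x ∈ U, DifferentiableAt ℝ h x := fun x hx =>
    (hd.contDiffAt (hU.mem_nhds hx)).differentiableAt one_ne_zero
  have hfc : ContinuousOn (fderiv ℝ h) U := hd.continuousOn_fderiv_of_isOpen hU le_rfl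
  refine fibStokesDecomposable_sub_comp_perm h (fun i x => fderiv ℝ h x (Pi.single i 1))
    (hsa.mono hCU hC) (hd.continuousOn.mono hCU)
    (fun i => (hsa.fderiv_apply_single hU hdiff i).mono hCU hC)
    (fun i => (hfc.clm_apply continuousOn_const).mono hCU) (fun i x hx _ => ?_) σ
  have hx' : Function.update x i (x i) ∈ U := by rw [Function.update_eq_self]; exact hCU hx
  have key := ((hdiff _ hx').hasFDerivAt).comp_hasDerivAt (x i) (hasDerivAt_update x i (x i))
  rw [Function.update_eq_self] at key
  exact key

/-- **Reflections for `C¹` data.** If `h` is `ℚ`-semialgebraic and `C¹` on an open set `U ⊇ [0,1]^N`, then for every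
coordinate `a` the difference `h(x) − h(x[a ↦ 1 − x_a])` is fibrewise-Stokes decomposable
(`fibStokesDecomposable_sub_comp_reflect` with the fibre derivative `x ↦ Dh(x) e_a`, semialgebraic by
Basu–Pollack–Roy, Prop. 3.22). [cite: KontsevichZagier2001, §1.2 rules (2), (3)] -/
theorem landenLeft_sub_comp_reflect_of_contDiffOn {N : ℕ} (U : Set (Fin N → ℝ)) (hU : IsOpen U)
    (hCU : Set.pi Set.univ (fun _ : Fin N => Set.Icc (0:ℝ) 1) ⊆ U) (h : (Fin N → ℝ) → ℝ)
    (hsa : IsSemialgebraicFunOn ℚ U h) (hd : ContDiffOn ℝ 1 h U) (a : Fin N) :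
    FibStokesDecomposable N (fun x => h x - h (Function.update x a (1 - x a))) := by
  have hC : IsSemialgebraic ℚ (Set.pi Set.univ (fun _ : Fin N => Set.Icc (0:ℝ) 1)) := by
    rw [← cube_eq_pi]; exact isSemialgebraic_cube
  have hdiff : ∀ x ∈ U, DifferentiableAt ℝ h x := fun x hx =>
    (hd.contDiffAt (hU.mem_nhds hx)).differentiableAt one_ne_zero
  have hfc : ContinuousOn (fderiv ℝ h) U := hd.continuousOn_fderiv_of_isOpen hU le_rfl
  refine fibStokesDecomposable_sub_comp_reflect a h (fun x => fderiv ℝ h x (Pi.single a 1))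
    (hsa.mono hCU hC) ((hsa.fderiv_apply_single hU hdiff a).mono hCU hC) (hd.continuousOn.mono hCU)
    ((hfc.clm_apply continuousOn_const).mono hCU) (fun x hx _ => ?_)
  have hx' : Function.update x a (x a) ∈ U := by rw [Function.update_eq_self]; exact hCU hx
  have key := ((hdiff _ hx').hasFDerivAt).comp_hasDerivAt (x a) (hasDerivAt_update x a (x a))
  rw [Function.update_eq_self] at key
  exact key

/-! ## The Landen leftovers -/

/-- Positivity of the Landen denominators: `0 < 1 − a p` for `a < 1` and `p ∈ [0,1]`. [folklore] -/
private theorem landenLeft_denom_pos {a p : ℝ} (ha1 : a < 1) (hp0 : 0 ≤ p) (hp1 : p ≤ 1) :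
    0 < 1 - a * p := by
  rcases le_or_gt 0 a with ha0 | ha0
  · nlinarith
  · nlinarith

/-- **Registered stub `stub_landenLeftovers` (rung 18, L1d): the Landen leftovers are soft.** On `[0,1]³`,
`(R₁ + R₂ + R₃)(x₀,x₂) + A + (R₃(x₁,x₂) − R₃(x₀,x₂))` is fibrewise-Stokes decomposable by rung 12 alone:
`R₁ + R₂ + R₃ = m − m ∘ ρ₀` for `m = (a/(1 − a x₂))/(1 − a x₂ x₀)` and the reflection `ρ₀ : x₀ ↦ 1 − x₀`
(`fibStokesDecomposable_sub_comp_reflect`), `A = h − h ∘ σ₀₁` for `h = ½ k(x₀,x₂) k_u(x₁,x₂)` and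
`R₃(x₁,x₂) − R₃(x₀,x₂) = −(g − g ∘ σ₀₁)` for `g = R₃(x₀,x₂)` (`fibStokesDecomposable_sub_comp_perm`); all data are
rational functions, `C¹` and `ℚ`-semialgebraic on the open semialgebraic neighbourhood
`{0 < 1 − a x₂ x₀} ∩ {0 < 1 − a x₂ x₁} ∩ {0 < 1 − a x₂}` of the cube. Transcendence-free and value-free.
[cite: KontsevichZagier2001, §1.2 rules (2), (3)] -/
theorem stub_landenLeftovers (a : ℝ) (ha : IsAlgebraic ℚ a) (ha1 : a < 1) :
    FibStokesDecomposable 3 (fun x =>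
      (a / (1 - a * x 2 * x 0) - a / ((1 - a * x 2) * (1 - a * x 2 + a * x 2 * x 0)) +
          (-a / (1 - a * x 2)) * (-(a * x 2) / (1 - a * x 2 * x 0))) +
      (1 / 2) * ((-(a * x 2) / (1 - a * x 2 * x 0)) * (-a / (1 - a * x 2 * x 1) ^ 2) -
          (-a / (1 - a * x 2 * x 0) ^ 2) * (-(a * x 2) / (1 - a * x 2 * x 1))) +
      ((-a / (1 - a * x 2)) * (-(a * x 2) / (1 - a * x 2 * x 1)) -
        (-a / (1 - a * x 2)) * (-(a * x 2) / (1 - a * x 2 * x 0)))) := by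
  -- the open semialgebraic neighbourhood `U` of the cube on which all denominators are positive
  obtain ⟨U, hU⟩ : ∃ U : Set (Fin 3 → ℝ),
      U = {x | 0 < 1 - a * x 2 * x 0 ∧ 0 < 1 - a * x 2 * x 1 ∧ 0 < 1 - a * x 2} := ⟨_, rfl⟩
  have hUo : IsOpen U := by
    have c0 : Continuous fun x : Fin 3 → ℝ => 1 - a * x 2 * x 0 := by fun_prop
    have c1 : Continuous fun x : Fin 3 → ℝ => 1 - a * x 2 * x 1 := by fun_prop
    have c2 : Continuous fun x : Fin 3 → ℝ => 1 - a * x 2 := by fun_prop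
    rw [hU]
    exact (isOpen_lt continuous_const c0).inter ((isOpen_lt continuous_const c1).inter
      (isOpen_lt continuous_const c2))
  have hUsa : IsSemialgebraic ℚ U := by
    have hV : IsSemialgebraic ℚ (Set.univ : Set (Fin 3 → ℝ)) :=
      Literature.ModelTheory.ExponentialFields.isSemialgebraic_univ
    have sx : ∀ i, IsSemialgebraicFunOn ℚ (Set.univ : Set (Fin 3 → ℝ)) (fun x => x i) := fun i =>
      isSemialgebraicFunOn_apply hV i
    have sa : IsSemialgebraicFunOn ℚ (Set.univ : Set (Fin 3 → ℝ)) (fun _ => a) :=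
      isSemialgebraicFunOn_const_of_isAlgebraic hV ha
    have s1 : IsSemialgebraicFunOn ℚ (Set.univ : Set (Fin 3 → ℝ)) (fun _ => (1:ℝ)) := by
      simpa using isSemialgebraicFunOn_const_natCast hV 1
    have n0 := (((sa.fun_mul (sx 2)).fun_mul (sx 0)).fun_sub s1).isSemialgebraic_sep_neg
    have n1 := (((sa.fun_mul (sx 2)).fun_mul (sx 1)).fun_sub s1).isSemialgebraic_sep_neg
    have n2 := ((sa.fun_mul (sx 2)).fun_sub s1).isSemialgebraic_sep_neg
    rw [hU]
    convert n0.inter (n1.inter n2) using 1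
    ext x
    simp only [Set.mem_setOf_eq, Set.mem_inter_iff, Set.mem_univ, true_and, sub_pos, sub_neg]
  -- the cube lies in `U`
  have hCU : Set.pi Set.univ (fun _ : Fin 3 => Set.Icc (0:ℝ) 1) ⊆ U := by
    intro x hx
    have hm : ∀ i, x i ∈ Set.Icc (0:ℝ) 1 := fun i => (Set.mem_univ_pi.mp hx) i
    have hprod : ∀ i j, 0 < 1 - a * x i * x j := fun i j => by
      rw [mul_assoc]
      exact landenLeft_denom_pos ha1 (mul_nonneg (hm i).1 (hm j).1) (mul_le_one₀ (hm i).2 (hm j).1 (hm j).2)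
    rw [hU]
    exact ⟨hprod 2 0, hprod 2 1, landenLeft_denom_pos ha1 (hm 2).1 (hm 2).2⟩
  -- the denominators do not vanish on `U`
  have hD0 : ∀ x ∈ U, 1 - a * x 2 * x 0 ≠ 0 := fun x hx => by rw [hU] at hx; exact hx.1.ne'
  have hD1 : ∀ x ∈ U, 1 - a * x 2 * x 1 ≠ 0 := fun x hx => by rw [hU] at hx; exact hx.2.1.ne'
  have hD2 : ∀ x ∈ U, 1 - a * x 2 ≠ 0 := fun x hx => by rw [hU] at hx; exact hx.2.2.ne'
  have hD0sq : ∀ x ∈ U, (1 - a * x 2 * x 0) ^ 2 ≠ 0 := fun x hx => pow_ne_zero 2 (hD0 x hx)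
  have hD1sq : ∀ x ∈ U, (1 - a * x 2 * x 1) ^ 2 ≠ 0 := fun x hx => pow_ne_zero 2 (hD1 x hx)
  -- semialgebraic atoms on `U`
  have sx : ∀ i, IsSemialgebraicFunOn ℚ U (fun x => x i) := fun i => isSemialgebraicFunOn_apply hUsa i
  have sa : IsSemialgebraicFunOn ℚ U (fun _ => a) := isSemialgebraicFunOn_const_of_isAlgebraic hUsa ha
  have s1 : IsSemialgebraicFunOn ℚ U (fun _ => (1:ℝ)) := by
    simpa using isSemialgebraicFunOn_const_natCast hUsa 1
  have shalf : IsSemialgebraicFunOn ℚ U (fun _ => (1 / 2 : ℝ)) :=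
    (isSemialgebraicFunOn_const_ratCast hUsa (1 / 2)).congr fun _ _ => by norm_num
  have sD0 : IsSemialgebraicFunOn ℚ U (fun x => 1 - a * x 2 * x 0) :=
    s1.fun_sub ((sa.fun_mul (sx 2)).fun_mul (sx 0))
  have sD1 : IsSemialgebraicFunOn ℚ U (fun x => 1 - a * x 2 * x 1) :=
    s1.fun_sub ((sa.fun_mul (sx 2)).fun_mul (sx 1))
  have sD2 : IsSemialgebraicFunOn ℚ U (fun x => 1 - a * x 2) := s1.fun_sub (sa.fun_mul (sx 2))
  -- (1) `R₁ + R₂ + R₃ = m − m ∘ ρ₀`, `m = (a/(1 − a x₂))/(1 − a x₂ x₀)`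
  have h1 := landenLeft_sub_comp_reflect_of_contDiffOn U hUo hCU
    (fun x => a / (1 - a * x 2) / (1 - a * x 2 * x 0)) ((sa.div sD2 hD2).div sD0 hD0)
    (by fun_prop (disch := assumption)) 0
  -- (2) `A = h − h ∘ σ₀₁`, `h = ½ k(x₀,x₂) k_u(x₁,x₂)`
  have h2 := landenLeft_sub_comp_perm_of_contDiffOn U hUo hCU
    (fun x => (1 / 2) * ((-(a * x 2) / (1 - a * x 2 * x 0)) * (-a / (1 - a * x 2 * x 1) ^ 2)))
    (shalf.fun_mul (((sa.fun_mul (sx 2)).fun_neg.div sD0 hD0).fun_mul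
      (sa.fun_neg.div (sD1.fun_pow 2) hD1sq)))
    (by fun_prop (disch := assumption)) (Equiv.swap 0 1)
  -- (3) `R₃(x₀,x₂) − R₃(x₁,x₂) = g − g ∘ σ₀₁`, `g = (−a/(1 − a x₂)) (−a x₂/(1 − a x₂ x₀))`
  have h3 := landenLeft_sub_comp_perm_of_contDiffOn U hUo hCU
    (fun x => (-a / (1 - a * x 2)) * (-(a * x 2) / (1 - a * x 2 * x 0)))
    ((sa.fun_neg.div sD2 hD2).fun_mul ((sa.fun_mul (sx 2)).fun_neg.div sD0 hD0))
    (by fun_prop (disch := assumption)) (Equiv.swap 0 1)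
  have hsum := fibStokesDecomposable_add 3 _ _ (fibStokesDecomposable_add 3 _ _ h1 h2)
    (fibStokesDecomposable_neg 3 _ h3)
  refine fibStokesDecomposable_congr_off_null 3 _ _ ∅
    Literature.ModelTheory.ExponentialFields.isSemialgebraic_empty measure_empty (fun x hx _ => ?_) hsum
  -- the pointwise identity on the cube
  have hxU : x ∈ U := hCU hx
  rw [hU] at hxU
  obtain ⟨d20, d21, d2⟩ := hxU
  have hm : ∀ i, x i ∈ Set.Icc (0:ℝ) 1 := fun i => (Set.mem_univ_pi.mp hx) i
  have d2r : 0 < 1 - a * x 2 + a * x 2 * x 0 := by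
    have h0 := hm 0
    have h2' := hm 2
    have := landenLeft_denom_pos ha1 (mul_nonneg h2'.1 (sub_nonneg.2 h0.2))
      (mul_le_one₀ h2'.2 (sub_nonneg.2 h0.2) (by linarith [h0.1]))
    nlinarith
  have hne : (2 : Fin 3) ≠ 0 := by decide
  simp only [Function.update_self, Function.update_of_ne hne, Equiv.swap_apply_left,
    Equiv.swap_apply_right, Equiv.swap_apply_of_ne_of_ne hne (by decide : (2 : Fin 3) ≠ 1)]
  have e : 1 - a * x 2 * (1 - x 0) = 1 - a * x 2 + a * x 2 * x 0 := by ring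
  rw [e]
  field_simp
  ring

end Summit.KontsevichZagierPeriods.KontsevichZagierPeriods.Cruxes.StokesGeneration.FibrewiseStokes

end
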